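import Mathlib
import Literature.AlgebraicGeometry.Resolution.AbhyankarMonomialUniformization
import Literature.AlgebraicGeometry.Resolution.TranscendenceDefect
import Literature.AlgebraicGeometry.Resolution.NormalizationFractions
import Literature.AlgebraicGeometry.Resolution.AffineDomainDimension
import Literature.RingTheory.KrullDimension.AffineCatenary
import Literature.RingTheory.KrullDimension.TranscendenceDegreeOfPoint
import Summits.ResolutionOfSingularities.ResolutionOfSingularities.Theorems.RadicialJungCleanModelsKK05MonomialModelIndep
import Summits.ResolutionOfSingularities.ResolutionOfSingularities.Theorems.AbhyankarShadowsSemivaluationShadowsQfgRankOne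
import HarnessLib

/-!
# DISCHARGE of the named fact `KnafKuhlmann2005_Thm11_monomialFormSepGen` (Knaf–Kuhlmann 2005, Thm. 1.1 WITH its monomial clause, GENERAL form:
# residue field separably generated of any transcendence degree) at universes `0, 0`

Route `RadicialJung`, crux `CleanModels` (stmt-ResolutionOfSingularities-15917); explicit-unit seat `decomp-res-hand-1` g4 (hand 1, strategy «direct: discharge
printed inputs by name»).  The Literature named fact `Literature.AlgebraicGeometry.Resolution.KnafKuhlmann2005_Thm11_monomialFormSepGen`
(`AbhyankarMonomialUniformization.lean`, ✓ p795997, typed by hand-2 g3; consumers ✓ p795998 `localMonomialization_at_abhyankarPlace_of_subfield` and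
`localMonomialization_at_abhyankarPlace_of_perfectSubfield`, which take it at `.{0, 0}` as the PRINTED input of the Abhyankar column — inseparable residue
fields included — of stub 7 `stub_cleanModelsDimGEFour` over ground fields finitely generated over a perfect field) is here PROVED at `.{0, 0}`.

hand-1 g3 discharged the residue-ALGEBRAIC special case `…_monomialForm` (✓ p796712) through a dimension count valid at CLOSED centres only (`dim R = dim A =
trdeg`).  Here the centre `𝔭` of the place on the model `A` is any prime, and the count is: `dim R = ht 𝔭 = dim A − dim A/𝔭` (affine domains are catenary,
✓ `Literature.RingTheory.KrullDimension.ringKrullDim_quotient_add_height`), `dim A = trdeg_k K = N`, `dim A/𝔭 = trdeg_k κ(𝔭) ≤ trdeg_k κ(v) = F`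
(`A/𝔭 ↪ κ(v)`), and `N − F = E ≥ ρ` (no transcendence defect, ✓ `transcendenceDefect_add_toNat_eq`; the Perron parameters `x'₁,…,x'_ρ` generating `𝔭 R`
have `ℤ`-independent values, ✓ `monomial_model_indep`); with Krull's `dim R ≤ μ(𝔪_R) ≤ ρ` this gives `dim R = ρ = μ(𝔪_R)`, i.e. `R` regular with regular
system of parameters `x'`.

* `KK05ValueBasis.monomial_localRing_indep` — ambient form: the model with `𝔪_R = (x')`, `dim R ≤ ρ`, `μ(𝔪_R) ≤ ρ`, `ℤ`-independent values, monomial read-off.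
* `KK05ValueBasis.isRegularLocalRing_of_le_ringKrullDim` — `μ(𝔪) ≤ ρ ≤ dim R ⇒ R` regular of dimension `ρ`.
* `KK05ValueBasis.linearIndependent_of_valuation_prod_zpow`, `KK05ValueBasis.residueTrdeg_eq_trdeg_comp` — bridges to `ratRank` / `residueTrdeg`.
* `KK05ValueBasis.knafKuhlmann2005_Thm11_monomialFormSepGen_holds : KnafKuhlmann2005_Thm11_monomialFormSepGen.{0, 0}` — THE DISCHARGE.

HONESTY: universes `0, 0` (the Abhyankar-place bridge ✓ `isAbhyankarPlace_top_of_transcendenceDefect_eq_zero` lives at `Type`); this is the instance every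
consumer uses.  Proves EXACTLY the Literature def; nothing here proves resolution of singularities in characteristic `p`. [OURS · DISCHARGE of a printed
input] counted 0.
-/

noncomputable section

set_option linter.dupNamespace false -- mandated namespace of this single-conjunct summit

open IsLocalRing
open Literature.AlgebraicGeometry.Resolution

namespace Summit.ResolutionOfSingularities.ResolutionOfSingularities.Theorems.RadicialJung.CleanModels

namespace KK05ValueBasis

universe u

/-- **Knaf–Kuhlmann's model at the local ring of the centre, before the dimension count (ambient form, any Abhyankar place with separably generated
residue field).**  A finitely generated `K`-algebra `A ⊆ 𝒪_V ∩ F` with `Frac A = F` and `Z ⊆ A`, whose local ring `R` at the centre of `V` is Noetherian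
with maximal ideal generated by `ρ` elements `a₁,…,a_ρ` of `ℤ`-INDEPENDENT values (hence `μ(𝔪_R) ≤ ρ` and `dim R ≤ ρ` by Krull's height theorem), in
which every non-zero `ζ ∈ Z` is a unit times a monomial. [cite: KnafKuhlmann2005, Thm. 1.1 («Moreover» clause) and its proof (p. 13)] -/
theorem monomial_localRing_indep {Ω : Type u} [Field Ω] (V : ValuationSubring Ω) (K F : Subfield Ω) (hfg : FGOver K F)
    (hKV : (K : Set Ω) ⊆ V) (hA : IsAbhyankarPlace V K F)
    (hsep : SeparablyGeneratedOver (resField V K) (resField V F))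
    (Z : Finset Ω) (hZ : ∀ z ∈ Z, z ∈ V ∧ z ∈ F) :
    ∃ (A : Subalgebra K Ω) (hAV : A.toSubring ≤ V.toSubring), (A : Set Ω) ⊆ F ∧ A.FG ∧
      (∀ w ∈ F, ∃ a ∈ A, ∃ b ∈ A, w = a / b) ∧ (∀ z ∈ Z, z ∈ A) ∧
      IsNoetherianRing (locAtCentre A.toSubring V) ∧
      ∃ (ρ : ℕ) (a : Fin ρ → locAtCentre A.toSubring V),
        (haveI := isLocalRing_locAtCentre hAV; IsLocalRing.maximalIdeal (locAtCentre A.toSubring V)) =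
          Ideal.span (Set.range a) ∧
        (haveI := isLocalRing_locAtCentre hAV; (IsLocalRing.maximalIdeal (locAtCentre A.toSubring V)).spanFinrank ≤ ρ) ∧
        ringKrullDim (locAtCentre A.toSubring V) ≤ ρ ∧
        (∀ j, ((a j : locAtCentre A.toSubring V) : Ω) ≠ 0) ∧
        (∀ m : Fin ρ → ℤ, (∏ j, V.valuation ((a j : locAtCentre A.toSubring V) : Ω) ^ (m j)) = 1 → m = 0) ∧
        ∀ z ∈ Z, z ≠ 0 → ∃ (u : locAtCentre A.toSubring V) (c : Fin ρ → ℕ), IsUnit u ∧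
          z = (u : Ω) * ∏ j, ((a j : locAtCentre A.toSubring V) : Ω) ^ (c j) := by
  classical
  obtain ⟨A, hAV, hAF, hAfg, hfrac, hZA, ρ, x', hx', -, hvi, hmono, hcentre⟩ :=
    monomial_model_indep V K F hfg hKV hA hsep Z hZ
  set R := locAtCentre A.toSubring V with hR
  haveI : IsLocalRing R := isLocalRing_locAtCentre hAV
  let a : Fin ρ → R := fun j => ⟨x' j, le_locAtCentre _ _ (hx' j).1⟩
  -- the maximal ideal of `R` is generated by the `x'ⱼ`
  have hspan : IsLocalRing.maximalIdeal R = Ideal.span (Set.range a) := by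
    apply le_antisymm
    · intro w hw
      have hvw : V.valuation (w : Ω) < 1 := (mem_maximalIdeal_locAtCentre_iff hAV w).mp hw
      obtain ⟨y, hy, z, hz, hvz, hwyz⟩ := w.2
      have hz0 : z ≠ 0 := ne_zero_of_valuation_eq_one hvz
      have hvy : V.valuation y < 1 := by
        have : V.valuation (w : Ω) = V.valuation y := by rw [hwyz, map_div₀, hvz, div_one]
        rwa [this] at hvw
      obtain ⟨t, ht, hvt, c, hc, htc⟩ := hcentre y hy hvy
      have ht0 : t ≠ 0 := ne_zero_of_valuation_eq_one hvt
      let r : Fin ρ → R := fun j =>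
        ⟨c j / (t * z), c j, hc j, t * z, mul_mem ht hz, by rw [map_mul, hvt, hvz, one_mul], rfl⟩
      have hwsum : w = ∑ j, r j * a j := by
        apply Subtype.ext
        rw [AddSubmonoidClass.coe_finsetSum]
        change (w : Ω) = ∑ j, c j / (t * z) * x' j
        have : (w : Ω) = (t * y) / (t * z) := by
          rw [hwyz, mul_div_mul_left _ _ ht0]
        rw [this, htc, Finset.sum_div]
        exact Finset.sum_congr rfl fun j _ => by ring
      rw [hwsum]
      exact Ideal.sum_mem _ fun j _ => Ideal.mul_mem_left _ _ (Ideal.subset_span ⟨j, rfl⟩)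
    · rw [Ideal.span_le]
      rintro _ ⟨j, rfl⟩
      exact (mem_maximalIdeal_locAtCentre_iff hAV _).mpr (hx' j).2.2
  -- Noetherian-ness
  letI : Algebra K A.toSubring := A.algebra
  haveI : Algebra.FiniteType K A.toSubring := A.fg_iff_finiteType.mp hAfg
  haveI hNA : IsNoetherianRing A.toSubring := Algebra.FiniteType.isNoetherianRing K A.toSubring
  set P : Ideal A.toSubring := subringCentre A.toSubring V hAV with hP
  haveI : IsLocalization.AtPrime R P := isLocalization_locAtCentre hAV
  haveI hNR : IsNoetherianRing R := IsLocalization.isNoetherianRing P.primeCompl R hNA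
  -- `μ(𝔪_R) ≤ ρ` and `dim R ≤ ρ` (Krull's height theorem)
  have hfin : (Set.range a).Finite := Set.finite_range a
  have hsf : (IsLocalRing.maximalIdeal R).spanFinrank ≤ ρ := by
    rw [hspan]
    refine (Submodule.spanFinrank_span_le_ncard_of_finite hfin).trans ?_
    rw [← Set.image_univ]
    refine (Set.ncard_image_le Set.finite_univ).trans ?_
    rw [Set.ncard_univ, Nat.card_eq_fintype_card, Fintype.card_fin]
  have hdimle : ringKrullDim R ≤ ρ := by
    rw [← IsLocalRing.maximalIdeal_height_eq_ringKrullDim]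
    have := (Ideal.height_le_spanFinrank (IsLocalRing.maximalIdeal R) Ideal.IsPrime.ne_top').trans
      (by exact_mod_cast hsf : ((IsLocalRing.maximalIdeal R).spanFinrank : ℕ∞) ≤ ρ)
    exact_mod_cast this
  -- value independence of the `aⱼ = x'ⱼ` (take `b = 1 ∈ K`)
  have hvi' : ∀ m : Fin ρ → ℤ, (∏ j, V.valuation ((a j : R) : Ω) ^ (m j)) = 1 → m = 0 :=
    fun m hm => hvi m ⟨1, K.one_mem, by rw [map_one]; exact hm⟩
  refine ⟨A, hAV, hAF, hAfg, hfrac, hZA, hNR, ρ, a, hspan, hsf, hdimle, fun j => (hx' j).2.1, hvi', fun z hz hz0 => ?_⟩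
  obtain ⟨c, u, huA, hvu, hzu⟩ := hmono z hz hz0
  let uR : R := ⟨u, le_locAtCentre _ _ huA⟩
  have huR : IsUnit uR := by
    by_contra hnu
    have := (not_isUnit_locAtCentre_iff hAV uR).mp hnu
    rw [show ((uR : R) : Ω) = u from rfl, hvu] at this
    exact lt_irrefl _ this
  exact ⟨uR, c, huR, hzu⟩

/-- **`μ(𝔪_R) ≤ ρ ≤ dim R ⇒ R` regular local of dimension `ρ`** (Noetherian local `R`): Krull's height theorem gives `dim R ≤ μ(𝔪_R)`, so all three are
equal. [folklore] -/
theorem isRegularLocalRing_of_le_ringKrullDim {R : Type*} [CommRing R] [IsLocalRing R] [IsNoetherianRing R] {ρ : ℕ}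
    (hsf : (IsLocalRing.maximalIdeal R).spanFinrank ≤ ρ) (hge : (ρ : WithBot ℕ∞) ≤ ringKrullDim R) :
    IsRegularLocalRing R ∧ ringKrullDim R = ρ := by
  have hdimle : ringKrullDim R ≤ (IsLocalRing.maximalIdeal R).spanFinrank := ringKrullDim_le_spanFinrank_maximalIdeal R
  have h1 : ringKrullDim R ≤ ρ := hdimle.trans (by exact_mod_cast hsf)
  have hdim : ringKrullDim R = ρ := le_antisymm h1 hge
  refine ⟨IsRegularLocalRing.of_spanFinrank_maximalIdeal_le R ?_, hdim⟩
  rw [hdim]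
  exact_mod_cast hsf

/-- **From multiplicative `ℤ`-independence of values to linear independence in the value group**: if `∏ⱼ v(aⱼ)^{mⱼ} = 1 ⇒ m = 0`, the classes of the
`v(aⱼ)` in `Γ_v` (written additively) are `ℤ`-linearly independent; hence `ρ ≤ rr v`. [folklore] -/
theorem linearIndependent_of_valuation_prod_zpow {K : Type*} [Field K] (O : ValuationSubring K) {ρ : ℕ} (a : Fin ρ → K)
    (ha0 : ∀ j, O.valuation (a j) ≠ 0)
    (hvi : ∀ m : Fin ρ → ℤ, (∏ j, O.valuation (a j) ^ (m j)) = 1 → m = 0) :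
    LinearIndependent ℤ (fun j => Additive.ofMul (Units.mk0 (O.valuation (a j)) (ha0 j))) := by
  classical
  rw [Fintype.linearIndependent_iff]
  intro g hg j
  have h1 : (∑ i, g i • Additive.ofMul (Units.mk0 (O.valuation (a i)) (ha0 i))) =
      Additive.ofMul (∏ i, (Units.mk0 (O.valuation (a i)) (ha0 i)) ^ (g i)) := by
    rw [ofMul_prod]
    exact Finset.sum_congr rfl fun i _ => (ofMul_zpow _ _).symm
  rw [h1, ofMul_eq_zero] at hg
  have h2 : (∏ i, O.valuation (a i) ^ (g i)) = 1 := by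
    have := congrArg (fun u : (ValuationSubring.ValueGroup O)ˣ => (u : ValuationSubring.ValueGroup O)) hg
    simpa only [Units.val_one, Units.coe_prod, Units.val_zpow_eq_zpow_val, Units.val_mk0] using this
  exact congrFun (hvi g h2) j

/-- The residual transcendence degree `F = tr.deg_k κ(𝒪)` computed with the explicit `k`-structure `k → 𝒪 → κ(𝒪)` of the named fact. [folklore] -/
theorem residueTrdeg_eq_trdeg_comp {k K : Type*} [Field k] [Field K] [Algebra k K] (O : ValuationSubring K)
    (hk : ∀ c : k, algebraMap k K c ∈ O) :
    residueTrdeg k O hk =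
      @Algebra.trdeg k (ResidueField O) _ _ ((IsLocalRing.residue O).comp ((algebraMap k K).codRestrict O hk)).toAlgebra := by
  unfold residueTrdeg
  congr 1

set_option maxHeartbeats 800000 in -- one long assembly: `k`-structures, affine dimension formula, transcendence bookkeeping
/-- **DISCHARGE of `KnafKuhlmann2005_Thm11_monomialFormSepGen` (Knaf–Kuhlmann 2005, Thm. 1.1 with the «Moreover» clause, GENERAL form: `K`-trivial Abhyankar
place with separably generated residue field extension) at universes `0, 0`.** [cite: KnafKuhlmann2005, Thm. 1.1] -/
theorem knafKuhlmann2005_Thm11_monomialFormSepGen_holds :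
    Literature.AlgebraicGeometry.Resolution.KnafKuhlmann2005_Thm11_monomialFormSepGen.{0, 0} := by
  intro k K _ _ _ hKfg O hk hD hsepgen Z hZ
  classical
  set K₀ : Subfield K := (algebraMap k K).fieldRange with hK₀
  have hK₀O : (K₀ : Set K) ⊆ O := by rintro x ⟨c, rfl⟩; exact hk c
  have hfg : FGOver K₀ (⊤ : Subfield K) := by
    obtain ⟨s, hs⟩ := hKfg
    refine ⟨s, ?_⟩
    have h1 : (IntermediateField.adjoin k (s : Set K)).toSubfield =
        Subfield.closure (Set.range (algebraMap k K) ∪ (s : Set K)) := rfl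
    rw [RingHom.coe_fieldRange, ← h1, hs]
    rfl
  have hAbh : IsAbhyankarPlace O K₀ ⊤ := isAbhyankarPlace_top_of_transcendenceDefect_eq_zero hKfg O hk hD
  -- the `k`-structure of the residue field (the one of the named fact)
  let φ : k →+* ResidueField O := (IsLocalRing.residue O).comp ((algebraMap k K).codRestrict O hk)
  letI algRes : Algebra k (ResidueField O) := φ.toAlgebra
  have hφmem : ∀ c : k, φ c ∈ resField O K₀ := fun c =>
    residue_mem_resField O ⟨algebraMap k K c, hk c⟩ ⟨c, rfl⟩
  have hφsurj : ∀ r ∈ resField O K₀, ∃ c : k, φ c = r := by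
    intro r hr
    obtain ⟨a, ⟨c, hc⟩, rfl⟩ := (mem_resField_iff O K₀ r).mp hr
    refine ⟨c, ?_⟩
    change IsLocalRing.residue O ⟨algebraMap k K c, hk c⟩ = IsLocalRing.residue O a
    congr 1
    exact Subtype.ext hc
  obtain ⟨s, hsb, hsepκ⟩ := hsepgen
  -- separably generated, in the ambient rendering over `resField O K₀ = φ(k)`
  have hsep' : SeparablyGeneratedOver (resField O K₀) (resField O ⊤) := by
    refine ⟨s, fun r _ => ?_, ?_, fun x _ => ?_⟩
    · obtain ⟨a, rfl⟩ := IsLocalRing.residue_surjective r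
      exact residue_mem_resField O a (Subfield.mem_top _)
    · -- algebraic independence over `φ(k)` from algebraic independence over `k`
      let f₀ : k →+* resField O K₀ := φ.codRestrict (resField O K₀) hφmem
      have hf₀ : Function.Surjective f₀ := fun r => by
        obtain ⟨c, hc⟩ := hφsurj r r.2
        exact ⟨c, Subtype.ext hc⟩
      have h := hsb.1.ringHom_of_comp_eq f₀ (RingHom.id (ResidueField O)) hf₀ (fun _ _ h => h)
        (RingHom.ext fun c => rfl)
      exact h
    · -- separability over `φ(k)(s) ⊇ k(s)`
      set L₁ := IntermediateField.adjoin k (s : Set (ResidueField O)) with hL₁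
      set L := IntermediateField.adjoin (resField O K₀) (s : Set (ResidueField O)) with hL
      haveI : Algebra.IsSeparable L₁ (ResidueField O) := hsepκ
      have hle : L₁.toSubfield ≤ L.toSubfield := by
        intro y hy
        have hy' : y ∈ Subfield.closure (Set.range (algebraMap k (ResidueField O)) ∪ (s : Set (ResidueField O))) := hy
        refine (Subfield.closure_le.mpr ?_) hy'
        rintro w (⟨c, rfl⟩ | hw)
        · exact L.algebraMap_mem ⟨φ c, hφmem c⟩
        · exact IntermediateField.subset_adjoin _ _ hw
      letI : Algebra L₁ L := (Subfield.inclusion hle).toAlgebra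
      haveI : IsScalarTower L₁ L (ResidueField O) := IsScalarTower.of_algebraMap_eq fun y => rfl
      exact IsSeparable.tower_top L (Algebra.IsSeparable.isSeparable L₁ x)
  -- the ambient-form model
  obtain ⟨A, hAV, -, hAfg, hfrac, hZA, hNR, ρ, a, hspan, hsf, hdimle, ha0, hvi, hmono⟩ :=
    monomial_localRing_indep O K₀ ⊤ hfg hK₀O hAbh hsep' Z (fun z hz => ⟨hZ z hz, trivial⟩)
  -- the same subring as a `k`-subalgebra
  let A' : Subalgebra k K :=
    { A.toSubring.toSubsemiring with
      algebraMap_mem' := fun c => A.algebraMap_mem (⟨algebraMap k K c, c, rfl⟩ : K₀) }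
  have hA'fg : A'.FG := by
    obtain ⟨t₂, ht₂⟩ := hAfg
    refine ⟨t₂, le_antisymm (Algebra.adjoin_le fun x hx => ?_) fun x hx => ?_⟩
    · change x ∈ A
      rw [← ht₂]
      exact Algebra.subset_adjoin hx
    · let T : Subalgebra K₀ K :=
        { (Algebra.adjoin k (t₂ : Set K)).toSubring.toSubsemiring with
          algebraMap_mem' := fun c => by
            obtain ⟨c', hc'⟩ := c.2
            change (c : K) ∈ Algebra.adjoin k (t₂ : Set K)
            rw [← hc']
            exact (Algebra.adjoin k (t₂ : Set K)).algebraMap_mem c' }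
      have hAT : A ≤ T := by
        rw [← ht₂]
        exact Algebra.adjoin_le fun y hy => (Algebra.subset_adjoin hy : y ∈ Algebra.adjoin k _)
      exact hAT hx
  have hfracA' : IsFractionRing A' K :=
    isFractionRing_of_forall_exists_div A'.toSubring fun z => by
      obtain ⟨a, ha, b, hb, hab⟩ := hfrac z trivial
      exact ⟨a, ha, b, hb, hab⟩
  have hAV' : A'.toSubring ≤ O.toSubring := hAV
  -- ### the dimension count `ρ ≤ dim R` (all objects over the subring `A.toSubring = A'.toSubring`)
  haveI : IsLocalRing (locAtCentre A.toSubring O) := isLocalRing_locAtCentre hAV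
  haveI : IsNoetherianRing (locAtCentre A.toSubring O) := hNR
  letI algkA : Algebra k A.toSubring := A'.algebra
  haveI hftA : Algebra.FiniteType k A.toSubring := A'.fg_iff_finiteType.mp hA'fg
  set P : Ideal A.toSubring := subringCentre A.toSubring O hAV with hP
  haveI : IsLocalization.AtPrime (locAtCentre A.toSubring O) P := isLocalization_locAtCentre hAV
  -- finiteness of the invariants
  have hN : Algebra.trdeg k K < Cardinal.aleph0 := trdeg_lt_aleph0_of_fg hKfg
  have hEfin := ratRank_lt_aleph0 O hk hN
  have hFfin := residueTrdeg_lt_aleph0 O hk hN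
  have hDEF := transcendenceDefect_add_toNat_eq O hk hN
  rw [hD, zero_add] at hDEF
  -- `dim A = trdeg_k K`
  obtain ⟨n', hn', htr'⟩ := exists_ringKrullDim_eq_and_trdeg_eq k A.toSubring
  have hNn' : Cardinal.toNat (Algebra.trdeg k K) = n' := by
    haveI : IsFractionRing A' K := hfracA'
    have h1 : Algebra.trdeg k K = Algebra.trdeg k A' := trdeg_eq_trdeg_of_isFractionRing A'
    have h2 : Algebra.trdeg k A' = n' := htr'
    rw [h1, h2, Cardinal.toNat_natCast]
  -- `ρ ≤ E`
  have ha0' : ∀ j, O.valuation ((a j : locAtCentre A.toSubring O) : K) ≠ 0 :=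
    fun j => (map_ne_zero O.valuation).mpr (ha0 j)
  have hli := linearIndependent_of_valuation_prod_zpow O (fun j => ((a j : locAtCentre A.toSubring O) : K)) ha0' hvi
  have hρE : ρ ≤ Cardinal.toNat (ratRank O) := by
    have h1 : ((ρ : ℕ) : Cardinal) ≤ ratRank O := by
      have := hli.cardinal_le_rank
      rw [Cardinal.mk_fin] at this
      exact this
    have := Cardinal.toNat_le_toNat h1 hEfin
    rwa [Cardinal.toNat_natCast] at this
  -- `dim (A/P) ≤ F`: `A/P ≅ ψ(A) ⊆ κ(O)`
  let ψ : A.toSubring →ₐ[k] ResidueField O :=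
    { toRingHom := (IsLocalRing.residue O).comp (Subring.inclusion hAV)
      commutes' := fun c => rfl }
  have hker : RingHom.ker ψ.rangeRestrict.toRingHom = P := by
    ext x
    rw [RingHom.mem_ker, hP, mem_subringCentre_iff]
    change ψ.rangeRestrict x = 0 ↔ _
    rw [← ZeroMemClass.coe_eq_zero]
    change IsLocalRing.residue O (Subring.inclusion hAV x) = 0 ↔ _
    rw [IsLocalRing.residue_eq_zero_iff, ValuationSubring.valuation_lt_one_iff]
    rfl
  haveI hftψ : Algebra.FiniteType k ψ.range :=
    Algebra.FiniteType.of_surjective ψ.rangeRestrict ψ.rangeRestrict_surjective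
  have hFeq : residueTrdeg k O hk = Algebra.trdeg k (ResidueField O) := residueTrdeg_eq_trdeg_comp O hk
  have hdimQ : ringKrullDim (A.toSubring ⧸ P) = (Cardinal.toNat (Algebra.trdeg k ψ.range) : WithBot ℕ∞) := by
    have e : (A.toSubring ⧸ P) ≃+* ψ.range :=
      (Ideal.quotEquivOfEq hker.symm).trans
        (RingHom.quotientKerEquivOfSurjective (f := ψ.rangeRestrict.toRingHom) ψ.rangeRestrict_surjective)
    rw [ringKrullDim_eq_of_ringEquiv e, Literature.RingTheory.KrullDimension.ringKrullDim_range_eq_toNat_trdeg ψ]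
  have hqF : Cardinal.toNat (Algebra.trdeg k ψ.range) ≤ Cardinal.toNat (residueTrdeg k O hk) := by
    have h1 : Algebra.trdeg k ψ.range ≤ Algebra.trdeg k (ResidueField O) :=
      trdeg_le_of_injective ψ.range.val Subtype.val_injective
    rw [hFeq]
    exact Cardinal.toNat_le_toNat h1 (by rw [← hFeq]; exact hFfin)
  -- `ht P + dim (A/P) = dim A` (affine domains are catenary) and `dim R = ht P`
  have hcat := Literature.RingTheory.KrullDimension.ringKrullDim_quotient_add_height k P
  have hRht : ringKrullDim (locAtCentre A.toSubring O) = P.height :=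
    IsLocalization.AtPrime.ringKrullDim_eq_height P (locAtCentre A.toSubring O)
  have hhle : (P.height : WithBot ℕ∞) ≤ ρ := hRht ▸ hdimle
  have hhle' : P.height ≤ (ρ : ℕ∞) := by exact_mod_cast hhle
  obtain ⟨h, hh⟩ := ENat.ne_top_iff_exists.mp (ne_top_of_le_ne_top (ENat.coe_ne_top ρ) hhle')
  rw [hdimQ, hn', ← hh] at hcat
  have hsum : Cardinal.toNat (Algebra.trdeg k ψ.range) + h = n' := by
    have : ((Cardinal.toNat (Algebra.trdeg k ψ.range) + h : ℕ) : WithBot ℕ∞) = (n' : WithBot ℕ∞) := by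
      rw [← hcat]; push_cast; rfl
    exact_mod_cast this
  have hρh : ρ ≤ h := by omega
  have hge : (ρ : WithBot ℕ∞) ≤ ringKrullDim (locAtCentre A.toSubring O) := by
    rw [hRht, ← hh]; exact_mod_cast hρh
  obtain ⟨hreg, hdim⟩ := isRegularLocalRing_of_le_ringKrullDim hsf hge
  exact ⟨A', hA'fg, hAV', hfracA', fun z hz => hZA z hz, hreg, ρ, a, hspan.symm, hdim, fun z hz hz0 => hmono z hz hz0⟩

end KK05ValueBasis

end Summit.ResolutionOfSingularities.ResolutionOfSingularities.Theorems.RadicialJung.CleanModels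

end
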